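import Literature.NumberTheory.EllipticCurves.ModularCurve
import Literature.NumberTheory.EllipticCurves.QuadraticTwist
import Literature.NumberTheory.EllipticCurves.GlobalMinimalModel
import Literature.NumberTheory.DiophantineGeometry.Conductor
import HarnessLib
import HarnessLib.Audit.Tags

/-!
# Candidates E-an-4a / E-an-4b (laws) with S-an-4 / E-an-4♯ (theorem targets): the CUSP-UNIPOTENT DEGREE
# LAWS at `2` and `3` (`CuspUnipotentDegreeLawAtTwo`, `CuspUnipotentDegreeLawAtThree`,
# `CuspWidthThreeTorsionSymbol`, `CuspSymbolInLatticeForcesThreeAtTwo`)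
# — cell `bsd-f2-manin` (D-0131 (3) frontier: the Manin constant at additive primes). `@[conjecture]`
# leaf (NOTHING asserted; definitions only).

HONEST FRAMING. LENS = analytic / period-lattice (planner `bsd-f2-manin-an` g1, HOME
`run/shared/lean/pub/bsd-f2-manin/MEMO-an.md` PART II §§9–17), Props VERBATIM from HOME/an/Sketch-an2.lean
(sha16 592a983c0c28c202, namespace `BsdF2ManinAn2`, farm rc 0; audited copy HOME/ref1-C8-an-g1.lean) with
`IsLatticeOptimal D` inlined as the lattice clause `Λ_W = c·Λ_f`. MECHANISM (memo §9): for `h² ∣ N` the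
translation `τ_h = (1 1/h; 0 1)` normalises `Γ₀(N)` (Atkin–Lehner 1970; Akbas–Singerman 1990), so
`∫_γ f|τ_h ∈ Λ_f`; with `a_{pn}(f) = 0` (`p² ∣ N`): `4 ∣ N`: `f|τ_2 = −f`; `9 ∣ N`: `f + 2 f|τ_3 = √−3 (f ⊗ χ₋₃)`.
At `4 ∥ N` the element `g = w_4 τ_2` has order `3` modulo `ℚˣΓ₀(N)` and fixes `f` (forces `ε_4 = −1`), so
`3·{∞, 1/(N/4)}_f ∈ Λ_f` (S-an-4) and `φ(cusp 1/(N/4))` is a rational point killed by `3`: either it is `O`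
(then `φ` factors through `X₀(N)/⟨g⟩` and `3 ∣ deg φ`, E-an-4♯) or `E(ℚ)` has a point of order `3` (E-an-4a).
At `27 ∣ N`, `g_η = τ_3^{±1} τ_3′` plays the same role on the `−3`-twist (E-an-4b).

THE ROWS. E-an-4a `CuspUnipotentDegreeLawAtTwo` (LAW with teeth): `4 ∥ N`, `D` lattice-optimal ⇒ `3 ∣ deg φ_D`
or `W(ℚ)` has a point of order `3`. E-an-4b `CuspUnipotentDegreeLawAtThree` (LAW): `27 ∣ N`, `D`
lattice-optimal ⇒ `3 ∣ deg φ_D` or the `−3`-twist has a rational point of order `3`. S-an-4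
`CuspWidthThreeTorsionSymbol` (THEOREM TARGET, statement-to-prove; newform-level): `4 ∥ N` ⇒
`3·{∞, 1/(N/4)}_f ∈ Λ_f`. E-an-4♯ `CuspSymbolInLatticeForcesThreeAtTwo` (THEOREM TARGET, the factorisation
step): `4 ∥ N`, `D` lattice-optimal, `{∞, 1/(N/4)}_f ∈ Λ_f` ⇒ `3 ∣ deg φ_D`. BC5 WITNESS (memo §12, HOME/an/g1-*,
alldegphi × allcurves N < 5·10⁵): 4a: 168 649 classes, `3 ∤ deg` in 26, all 26 with `3 ∣ #E(ℚ)_tors`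
(census2.out); 4b: 198 592 classes, `3 ∤ deg` only for 27a, 54b (both: the twist has 3-torsion). Refuter
verdicts: REF1 **E-an-4a, E-an-4b, S-an-4, E-an-4♯ all SURVIVE** 2026-08-27T16:22Z (HOME/REFUTER-ref1.md §R4:
rc 0, 10/10 BC7 CLEAN; independent engines N < 5·10⁵: 4a 0 violations / 168 649 with the 26 exceptions
reproduced exactly, all 3-torsion; 4b 0 / 198 592, 27a1/54b1: rational 3-point on the −3-twist verified by
the 3-division polynomial; read-backs: ℕ-division `N/4` exact under `4 ∣ N`, the `addOrderOf` disjunct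
excludes `O`); REF2 (HOME/REFUTER-ref2.md, v3 §C″): 4a NOT-IN-PRINT, FOLKLORE-PROVABLE theorem candidate
(Atkin–Lehner 1970 §4 / Akbas–Singerman 1990 / Bars 2008: `w₄τ₂` of order 3 at `4 ∥ N`; Watkins 2002 §4
records the 3-anomaly unexplained; Calegari–Emerton 2009 covers `ℓ = 2` only); 4b NOT-IN-PRINT,
FOLKLORE-PROVABLE modulo the field of definition of `τ₃` (N = 108 in the Kenku–Momose exceptional list is in
range). Cross-lens: 4a/4b = the `(2, 3)` / `(3, 3)` clauses of the desc leaf `ComponentExponentDegreeLawTorsion`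
with the sharper exclusion.
-/

noncomputable section

open scoped MatrixGroups ModularForm

open CongruenceSubgroup WeierstrassCurve
  Literature.NumberTheory.EllipticCurves Literature.NumberTheory.EllipticCurves.ModularForms

namespace Summit.BirchSwinnertonDyer.Rank1Residual.ManinAdditive

/-- **S-an-4 `CuspWidthThreeTorsionSymbol` (cell bsd-f2-manin; THEOREM TARGET — statement-to-prove, not
in print as stated; nothing asserted):** for a newform `f` on `Γ₀(N)` with `4 ∥ N`,
`3 · {∞, 1/(N/4)}_f ∈ Λ_f` (`g = w_4 τ_2` satisfies `g³ ∈ ℚˣΓ₀(N)`, `f|g = f`, `g∞ ~ 1/(N/4)`).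
[cite: Watkins2002, §4 (pp. 499–500: the unexplained excess of 3 ∣ deg φ that this symbol explains; the
period-lattice statement itself is NOT in print — cell bsd-f2-manin MEMO-an.md §§9–11, S-an-4)] -/
@[conjecture] def CuspWidthThreeTorsionSymbol : Prop :=
  ∀ {N : ℕ} [NeZero N] (f : CuspForm (Gamma0 N) 2), IsNewform0 f → 2 ^ 2 ∣ N → ¬ 2 ^ 3 ∣ N →
    ∃ w ∈ periodLattice f, 3 * modularSymbol f (1 / ((N / 4 : ℕ) : ℚ)) = w

/-- **E-an-4♯ `CuspSymbolInLatticeForcesThreeAtTwo` (cell bsd-f2-manin; THEOREM TARGET — the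
factorisation step, not in print; nothing asserted):** `4 ∥ N`, `D` lattice-optimal (`Λ_W = c·Λ_f`): if
`{∞, 1/(N/4)}_f ∈ Λ_f` (i.e. `φ(1/(N/4)) = O`) then `φ` factors through `X₀(N)/⟨w_4τ_2⟩` and `3 ∣ deg φ_D`.
[cite: Watkins2002, §4 (pp. 499–500, shape only; the degree consequence for optimal parametrisations is
NOT in print — cell bsd-f2-manin MEMO-an.md §11, E-an-4♯)] -/
@[conjecture] def CuspSymbolInLatticeForcesThreeAtTwo : Prop :=
  ∀ (W : WeierstrassCurve ℚ) [W.IsElliptic] [W.IsGloballyMinimal] [NeZero (W.conductorNorm ℤ)]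
    (D : ModularParametrizationData W (W.conductorNorm ℤ)),
    (∀ z ∈ D.L.lattice, ∃ w ∈ periodLattice D.f, z = D.c * w) →
    2 ^ 2 ∣ W.conductorNorm ℤ → ¬ 2 ^ 3 ∣ W.conductorNorm ℤ →
    modularSymbol D.f (1 / ((W.conductorNorm ℤ / 4 : ℕ) : ℚ)) ∈ periodLattice D.f →
    3 ∣ D.modularDegree

/-- **Candidate E-an-4a `CuspUnipotentDegreeLawAtTwo` (cell bsd-f2-manin; a LAW with teeth, NOT in print,
nothing asserted):** `4 ∥ N = W.conductorNorm ℤ`, `W` globally minimal, `D` lattice-optimal at level `N`: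
`3 ∣ deg φ_D` or `W(ℚ)` has a point of order `3` (`= φ(cusp 1/(N/4))`).
[cite: Watkins2002, §4 (pp. 499–500: the unexplained excess of 3 ∣ deg φ; the law is NOT in print — cell
bsd-f2-manin MEMO-an.md §12, E-an-4a)] -/
@[conjecture] def CuspUnipotentDegreeLawAtTwo : Prop :=
  ∀ (W : WeierstrassCurve ℚ) [W.IsElliptic] [W.IsGloballyMinimal] [NeZero (W.conductorNorm ℤ)]
    (D : ModularParametrizationData W (W.conductorNorm ℤ)),
    (∀ z ∈ D.L.lattice, ∃ w ∈ periodLattice D.f, z = D.c * w) →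
    2 ^ 2 ∣ W.conductorNorm ℤ → ¬ 2 ^ 3 ∣ W.conductorNorm ℤ →
    3 ∣ D.modularDegree ∨ ∃ P : W.toAffine.Point, addOrderOf P = 3

/-- **Candidate E-an-4b `CuspUnipotentDegreeLawAtThree` (cell bsd-f2-manin; a LAW with teeth, NOT in print,
nothing asserted):** `27 ∣ N = W.conductorNorm ℤ`, `W` globally minimal, `D` lattice-optimal at level `N`:
`3 ∣ deg φ_D` or the `−3`-twist `W ⊗ χ₋₃` has a rational point of order `3`.
[cite: Watkins2002, §4 (pp. 499–500, shape only; the law is NOT in print — cell bsd-f2-manin MEMO-an.md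
§12, E-an-4b)] -/
@[conjecture] def CuspUnipotentDegreeLawAtThree : Prop :=
  ∀ (W : WeierstrassCurve ℚ) [W.IsElliptic] [W.IsGloballyMinimal] [NeZero (W.conductorNorm ℤ)]
    (D : ModularParametrizationData W (W.conductorNorm ℤ)),
    (∀ z ∈ D.L.lattice, ∃ w ∈ periodLattice D.f, z = D.c * w) →
    3 ^ 3 ∣ W.conductorNorm ℤ →
    3 ∣ D.modularDegree ∨ ∃ P : (W.quadraticTwist ((-3 : ℤ) : ℚ)).toAffine.Point, addOrderOf P = 3

end Summit.BirchSwinnertonDyer.Rank1Residual.ManinAdditive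

end
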